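import Summits.QuantumFields.YangMills.Theorems.ToronSmallBallOwnAxisShiftCounting
import Summits.QuantumFields.YangMills.Theorems.QuantileBitPuritySectorGoodReduction
import Summits.QuantumFields.YangMills.Theorems.LuscherReductionTwistedTraceScalingElectricSplit
import Summits.QuantumFields.YangMills.Theorems.LuscherReductionTwistedTraceScalingLatticeHS
import HarnessLib

/-!
# The own-axis sheet shift: the periodic-sector off-core strip estimate at fixed `β`, `L` from seven numeric inequalities

Support module (`--supports` stmt-QuantumFields-24089, `ToronSmallBall.PeriodicOffCoreStripWindowDeep`; seat ym-dw-p1 g15).  Everything geometric is done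
(modules `…OwnAxisShiftCounting`, `…Domination`, `…Cost`, `…Good`); here the constants are frozen.  On the ring of `2L` slices through the untwisted seam,
with closeness scale `η` (good event `s = η²`, `t = η`), strip half-width `w`, core radius `c₀`, floor `σ`, angular step `θ' > 5w`, `K` shifts and the
universal domination constant `C = 2e`:

★ `sectorWeight_strip_le_rpow_of_numerics`: if `β ≥ 200`, `0 < σ ≤ 1`, `4L²η ≤ c₀/2 − σ`, `Kθ' ≤ σ/2`, the COST inequality
`12 β L⁴ ((Kθ'·2Lη/σ)² + 2(Kθ'·2Lη/σ)η) ≤ 1`, the JACOBIAN inequality `4L⁴·(Kθ'/σ) ≤ 1/2`, the BAD-FIELD inequality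
`4L e^{−βη²/2} (β^{315L³})^{2L} ≤ β^{−a}/2` and the COUNTING inequality `32e/K ≤ β^{−a}/2` hold, then
`W₀(𝟙_{|polDist U₀ − polDist(S U₀)| ≤ w, c₀ < polDist U₀}) ≤ β^{−a} · Z_phys(2L)`.
(Cards: `#E = #P = 3L³` (tree `card_edge_three`, `TwoLattice.Electric.card_site`), `#plane ≤ L³`; `(1 − x)^{4L⁴} ≥ 1 − 4L⁴x` (Bernoulli); `W₀(1) ≤ 8 Z_phys`; bad fields by
`TT.sectorWeight_indicator_compl_goodEvent_le_floor`.)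

HONEST FRAMING: fixed-lattice bookkeeping; nothing about infinite volume, the continuum limit or the Clay gap.  No `sorry`, no new axiom, no new
definition.  References: [cite: Luscher1983, §2]; [cite: MontvayMunster1994, (3.145)].
-/

set_option autoImplicit false

noncomputable section

open MeasureTheory Set Function
open scoped BigOperators
open Literature.MathematicalPhysics.QuantumLattice (su2Quat)
open Literature.MathematicalPhysics.QuantumFieldTheory hiding su2Quat_mul

namespace Summit.QuantumFields.YangMills.Theorems.FemtoTransferGap.OwnAxis

open ClassShift FlatSheet
open Summit.QuantumFields.YangMills.Theorems.FemtoTransferGap.TT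

variable {L : ℕ} [NeZero L]

/-! ## §1 Cards and elementary inequalities -/

/-- `#Plaquette ≤ 3L³` and `= 3L³` packaged as the bad-field exponent: `8·#P + 97·#E = 315 L³`
(cards: `TwoLattice.Electric.card_site`, `card_edge_three`; the plaquette count is re-derived in place). [folklore] -/
theorem badExponent_eq : 8 * Fintype.card (Plaquette 3 L) + 97 * Fintype.card (Edge 3 L) = 315 * L ^ 3 := by
  have hP : Fintype.card (Plaquette 3 L) = 3 * L ^ 3 := by
    rw [Fintype.card_prod, TwoLattice.Electric.card_site, show Fintype.card {p : Fin 3 × Fin 3 // p.1 < p.2} = 3 from by decide]; ring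
  rw [hP, card_edge_three]; ring

/-- `#P · b + #E · b = 6L³ · b`. [folklore] -/
theorem card_plaquette_add_card_edge_mul (b : ℝ) :
    (Fintype.card (Plaquette 3 L) : ℝ) * b + (Fintype.card (Edge 3 L) : ℝ) * b = 6 * (L : ℝ) ^ 3 * b := by
  have hP : Fintype.card (Plaquette 3 L) = 3 * L ^ 3 := by
    rw [Fintype.card_prod, TwoLattice.Electric.card_site, show Fintype.card {p : Fin 3 × Fin 3 // p.1 < p.2} = 3 from by decide]; ring
  rw [hP, card_edge_three]; push_cast; ring

/-- `#plane ≤ L³`. [folklore] -/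
theorem card_plane_le : (Finset.univ.filter (fun x : Site 3 L => x 0 = 0)).card ≤ L ^ 3 := by
  calc (Finset.univ.filter (fun x : Site 3 L => x 0 = 0)).card ≤ (Finset.univ : Finset (Site 3 L)).card := Finset.card_filter_le _ _
    _ = L ^ 3 := by rw [Finset.card_univ, TwoLattice.Electric.card_site]

/-- **Bernoulli for the Jacobian**: `0 ≤ x ≤ 1`, `m·x ≤ 1/2` ⇒ `((1 − x)^m)⁻¹ ≤ 2`. [folklore] -/
theorem inv_pow_one_sub_le_two {x : ℝ} {m : ℕ} (hx1 : x ≤ 1) (h : (m : ℝ) * x ≤ 1 / 2) : ((1 - x) ^ m)⁻¹ ≤ 2 := by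
  have hb : 1 - (m : ℝ) * x ≤ (1 - x) ^ m := by
    have := one_add_mul_le_pow (a := -x) (by linarith) m
    simpa [sub_eq_add_neg, mul_neg] using this
  have hpos : 0 < (1 - x) ^ m := by linarith
  rw [inv_le_comm₀ hpos (by norm_num)]
  linarith

/-- The periodic sector weight is at most `8 Z_phys`. [cite: MontvayMunster1994, (3.145)] -/
theorem sectorWeight_zero_one_le (β : ℝ) (n : ℕ) :
    sectorWeight (L := L) β n (fun _ => false) (fun _ _ => (1 : ℝ)) ≤ 8 * physTraceSucc L β n := by
  rw [physTraceSucc_eq_sum_sectorWeight]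
  have h := Finset.single_le_sum (f := fun z : Fin 3 → Bool => sectorWeight (L := L) β n z fun _ _ => (1 : ℝ))
    (fun z _ => sectorWeight_nonneg β n z fun _ _ => zero_le_one) (Finset.mem_univ (fun _ : Fin 3 => false))
  linarith

/-- `4 / (e^{−1/2} · 8/(3π³)) ≤ 200`. [folklore] -/
theorem floor_const_le : 4 / (Real.exp (-(1 / 2 : ℝ)) * (8 / (3 * Real.pi ^ 3))) ≤ 200 := by
  have hπ : Real.pi ≤ 3.15 := Real.pi_lt_d2.le
  have hπ0 : 0 < Real.pi := Real.pi_pos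
  have he : Real.exp (1 / 2 : ℝ) ≤ 3 := by
    have := Real.exp_one_lt_d9
    have h1 : Real.exp (1 / 2 : ℝ) ≤ Real.exp 1 := Real.exp_le_exp.2 (by norm_num)
    linarith
  have hexp : (1 : ℝ) / 3 ≤ Real.exp (-(1 / 2 : ℝ)) := by
    rw [Real.exp_neg, le_inv_comm₀ (by norm_num) (Real.exp_pos _)]
    linarith
  have hπ3 : Real.pi ^ 3 ≤ 32 := by
    have h := pow_le_pow_left₀ hπ0.le hπ 3
    have : (3.15 : ℝ) ^ 3 ≤ 32 := by norm_num
    linarith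
  have hfrac : (8 : ℝ) / (3 * 32) ≤ 8 / (3 * Real.pi ^ 3) := by
    apply div_le_div_of_nonneg_left (by norm_num) (by positivity) (by nlinarith)
  have hprod : (1 : ℝ) / 3 * (8 / (3 * 32)) ≤ Real.exp (-(1 / 2 : ℝ)) * (8 / (3 * Real.pi ^ 3)) :=
    mul_le_mul hexp hfrac (by norm_num) (Real.exp_pos _).le
  calc 4 / (Real.exp (-(1 / 2 : ℝ)) * (8 / (3 * Real.pi ^ 3))) ≤ 4 / ((1 : ℝ) / 3 * (8 / (3 * 32))) :=
        div_le_div_of_nonneg_left (by norm_num) (by norm_num) hprod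
    _ ≤ 200 := by norm_num

/-! ## §2 The window estimate from numeric inequalities -/

set_option maxHeartbeats 800000 in
/-- ★ **The periodic-sector off-core strip estimate at fixed `β`, `L` from numeric inequalities.**  See the module docstring.
[cite: Luscher1983, §2] [cite: MontvayMunster1994, (3.145)] -/
theorem sectorWeight_strip_le_rpow_of_numerics {β a η w c₀ σ θ' : ℝ} {K : ℕ} (hβ : 200 ≤ β) (hη : 0 < η) (hw : 0 < w) (hθ' : 5 * w < θ')
    (hσ : 0 < σ) (hσ1 : σ ≤ 1) (hfl : 4 * (L * (L * η)) ≤ c₀ / 2 - σ) (hK : 1 ≤ K) (hKσ : K * θ' ≤ σ / 2)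
    (hQ : 12 * β * (L : ℝ) ^ 4 * ((K * θ' * (2 * (L * η) / σ)) ^ 2 + 2 * (K * θ' * (2 * (L * η) / σ)) * η) ≤ 1)
    (hJ : 4 * (L : ℝ) ^ 4 * (K * θ' / σ) ≤ 1 / 2)
    (hG : 4 * L * Real.exp (-(β * η ^ 2 / 2)) * (β ^ (315 * L ^ 3)) ^ (2 * L) ≤ β ^ (-a) / 2)
    (hKa : 32 * Real.exp 1 / K ≤ β ^ (-a) / 2) :
    sectorWeight β (2 * L - 1) (fun _ => false) (fun Us _ =>
        {U : GaugeConfig 3 L SU2 | |polDist U - polDist (configPerm (Equiv.swap (0 : Fin 3) 1) U)| ≤ w ∧ c₀ < polDist U}.indicator (fun _ => (1 : ℝ)) (Us 0)) ≤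
      β ^ (-a) * physTrace L β (2 * L) := by
  have hL1 : 1 ≤ L := NeZero.one_le
  have hLr : (1 : ℝ) ≤ L := by exact_mod_cast hL1
  have hβ0 : 0 ≤ β := by linarith
  have hβ1 : 1 ≤ β := by linarith
  set n : ℕ := 2 * L - 1 with hn
  have hn1 : 1 ≤ n := by omega
  have hn2 : n + 1 = 2 * L := by omega
  have hnr : (n : ℝ) ≤ 2 * L := by
    have : (n : ℝ) + 1 = 2 * L := by exact_mod_cast hn2
    linarith
  have hθ'0 : 0 < θ' := by linarith
  have hKθ0 : 0 ≤ (K : ℝ) * θ' := by positivity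
  -- the floor hypothesis
  have hsq : Real.sqrt (η ^ 2) = η := Real.sqrt_sq hη.le
  have hσle : σ ≤ c₀ / 2 - 2 * (L * (L * Real.sqrt (η ^ 2))) - n * (L * η) := by
    rw [hsq]
    have : (n : ℝ) * (L * η) ≤ 2 * (L * (L * η)) := by
      have h0 : 0 ≤ L * η := by positivity
      nlinarith
    linarith
  have hKπ : (K : ℝ) * θ' ≤ Real.pi / 2 := by linarith [Real.pi_gt_three]
  -- the uniform domination constant `C = 2e`
  set C : ℝ := 2 * Real.exp 1 with hC
  have hC0 : 0 ≤ C := by positivity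
  have hCθ : ∀ θ : ℝ, |θ| ≤ K * θ' →
      Real.exp (β * ((n + 1 : ℕ) * (Fintype.card (Plaquette 3 L) * ((|θ| * (2 * (L * Real.sqrt (η ^ 2)) / σ)) ^ 2 + 2 * (|θ| * (2 * (L * Real.sqrt (η ^ 2)) / σ)) * Real.sqrt (η ^ 2)) +
          Fintype.card (Edge 3 L) * ((|θ| * (2 * (L * η) / σ)) ^ 2 + 2 * (|θ| * (2 * (L * η) / σ)) * η)))) *
        ((((1 - |θ| / σ) ^ 2)⁻¹) ^ (Finset.univ.filter (fun x : Site 3 L => x 0 = 0)).card) ^ (n + 1) ≤ C := by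
    intro θ hθ
    rw [hsq, card_plaquette_add_card_edge_mul, hn2]
    have hθ0 : 0 ≤ |θ| := abs_nonneg θ
    -- the exponent is at most `1`
    set X : ℝ := 2 * (L * η) / σ with hX
    have hX0 : 0 ≤ X := by positivity
    have hb : (|θ| * X) ^ 2 + 2 * (|θ| * X) * η ≤ (K * θ' * X) ^ 2 + 2 * (K * θ' * X) * η := by
      have h1 : |θ| * X ≤ K * θ' * X := mul_le_mul_of_nonneg_right hθ hX0
      have h2 : 0 ≤ |θ| * X := by positivity
      nlinarith
    have hexp : β * (((2 * L : ℕ) : ℝ) * (6 * (L : ℝ) ^ 3 * ((|θ| * X) ^ 2 + 2 * (|θ| * X) * η))) ≤ 1 := by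
      have hb0 : 0 ≤ (|θ| * X) ^ 2 + 2 * (|θ| * X) * η := by positivity
      calc β * (((2 * L : ℕ) : ℝ) * (6 * (L : ℝ) ^ 3 * ((|θ| * X) ^ 2 + 2 * (|θ| * X) * η)))
          = 12 * β * (L : ℝ) ^ 4 * ((|θ| * X) ^ 2 + 2 * (|θ| * X) * η) := by push_cast; ring
        _ ≤ 12 * β * (L : ℝ) ^ 4 * ((K * θ' * X) ^ 2 + 2 * (K * θ' * X) * η) := mul_le_mul_of_nonneg_left hb (by positivity)
        _ ≤ 1 := hQ
    have hE : Real.exp (β * (((2 * L : ℕ) : ℝ) * (6 * (L : ℝ) ^ 3 * ((|θ| * X) ^ 2 + 2 * (|θ| * X) * η)))) ≤ Real.exp 1 := Real.exp_le_exp.2 hexp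
    -- the Jacobian is at most `2`
    set x : ℝ := |θ| / σ with hx
    have hx0 : 0 ≤ x := by positivity
    have hxK : x ≤ K * θ' / σ := div_le_div_of_nonneg_right hθ hσ.le
    have hx1 : x ≤ 1 := by
      have : (K : ℝ) * θ' / σ ≤ 1 / 2 := by rw [div_le_iff₀ hσ]; linarith
      linarith
    have hKx : (K : ℝ) * θ' / σ ≤ 1 / 2 := by rw [div_le_iff₀ hσ]; linarith
    have h1x : 0 < 1 - x := by linarith
    have hbase : 1 ≤ ((1 - x) ^ 2)⁻¹ := (one_le_inv₀ (by positivity)).2 (pow_le_one₀ h1x.le (by linarith))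
    set y : ℝ := ((1 - x) ^ 2)⁻¹ with hy
    have hy0 : 0 ≤ y := by positivity
    have hstep1 : (y ^ (Finset.univ.filter (fun x : Site 3 L => x 0 = 0)).card) ^ (2 * L) ≤ (y ^ (L ^ 3)) ^ (2 * L) :=
      pow_le_pow_left₀ (by positivity) (pow_le_pow_right₀ hbase card_plane_le) (2 * L)
    have hstep2 : (y ^ (L ^ 3)) ^ (2 * L) = ((1 - x) ^ (4 * L ^ 4))⁻¹ := by
      rw [hy, ← pow_mul, inv_pow, ← pow_mul]
      congr 2
      ring
    have hm : ((4 * L ^ 4 : ℕ) : ℝ) * x ≤ 1 / 2 := by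
      have h4 : ((4 * L ^ 4 : ℕ) : ℝ) * x ≤ 4 * (L : ℝ) ^ 4 * (K * θ' / σ) := by
        push_cast; exact mul_le_mul_of_nonneg_left hxK (by positivity)
      linarith
    have hJ' : (y ^ (Finset.univ.filter (fun x : Site 3 L => x 0 = 0)).card) ^ (2 * L) ≤ 2 := by
      rw [hstep2] at hstep1
      exact hstep1.trans (inv_pow_one_sub_le_two hx1 hm)
    have hfin := mul_le_mul hE hJ' (by positivity) (Real.exp_pos _).le
    have hCe : Real.exp 1 * 2 = C := by rw [hC]; ring
    rw [hCe] at hfin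
    exact hfin
  -- counting
  have hmain := sectorWeight_strip_le (L := L) hβ0 n hK hσ hσ1 hσle hw.le hθ' hKσ hKπ hC0 hCθ
  -- the bad fields
  have hbad := sectorWeight_indicator_compl_goodEvent_le_floor (L := L) hn1 (by linarith) (floor_const_le.trans hβ) (fun _ => false) (η ^ 2) hη.le
  have hZ : physTrace L β (2 * L) = physTraceSucc L β n := rfl
  have hZ0 : 0 ≤ physTraceSucc L β n := by
    have h := floor_le_physTraceSucc (L := L) hn1 (by linarith) (floor_const_le.trans hβ)
    exact le_trans (by positivity) h
  have hpow : (β ^ (8 * Fintype.card (Plaquette 3 L) + 97 * Fintype.card (Edge 3 L))) ^ (n + 1) = (β ^ (315 * L ^ 3)) ^ (2 * L) := by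
    rw [badExponent_eq, hn2]
  have hn' : ((n : ℝ) + 1) = 2 * L := by exact_mod_cast hn2
  have hbad' : sectorWeight β n (fun _ => false) (fun Us g => (goodEvent (L := L) n (fun _ => false) (η ^ 2) η)ᶜ.indicator (fun _ => (1 : ℝ)) (g, Us)) ≤
      β ^ (-a) / 2 * physTraceSucc L β n := by
    refine hbad.trans ?_
    rw [hpow, hn', show β / 2 * η ^ 2 = β * η ^ 2 / 2 by ring]
    calc 2 * (L : ℝ) * (Real.exp (-(β * η ^ 2 / 2)) + Real.exp (-(β * η ^ 2 / 2))) * (β ^ (315 * L ^ 3)) ^ (2 * L) * physTraceSucc L β n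
        = (4 * L * Real.exp (-(β * η ^ 2 / 2)) * (β ^ (315 * L ^ 3)) ^ (2 * L)) * physTraceSucc L β n := by ring
      _ ≤ β ^ (-a) / 2 * physTraceSucc L β n := mul_le_mul_of_nonneg_right hG hZ0
  -- the periodic sector total
  have hW1 := sectorWeight_zero_one_le (L := L) β n
  have hcount : 2 * (C / K) * sectorWeight (L := L) β n (fun _ => false) (fun _ _ => (1 : ℝ)) ≤ β ^ (-a) / 2 * physTraceSucc L β n := by
    have hCK : 0 ≤ 2 * (C / K) := by positivity
    calc 2 * (C / K) * sectorWeight (L := L) β n (fun _ => false) (fun _ _ => (1 : ℝ)) ≤ 2 * (C / K) * (8 * physTraceSucc L β n) :=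
          mul_le_mul_of_nonneg_left hW1 hCK
      _ = (32 * Real.exp 1 / K) * physTraceSucc L β n := by rw [hC]; ring
      _ ≤ β ^ (-a) / 2 * physTraceSucc L β n := mul_le_mul_of_nonneg_right hKa hZ0
  rw [hZ]
  linarith

end Summit.QuantumFields.YangMills.Theorems.FemtoTransferGap.OwnAxis

end
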